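import Mathlib
import Summits.Ventures.HodgeRepro2.Hypothesis
import Summits.Ventures.HodgeRepro2.BallActionU21
import Summits.Ventures.HodgeRepro2.InvariantFormsGroup
import Summits.Ventures.HodgeRepro2.Neat
import Summits.Ventures.HodgeRepro2.Level
import Summits.Ventures.HodgeRepro2.LevelNeat
import Summits.Ventures.HodgeRepro2.DefiniteUnitaryBounded
import Summits.Ventures.HodgeRepro2.IntegralUnitaryDiscrete
import Summits.Ventures.HodgeRepro2.LevelDiscrete
import Summits.Ventures.HodgeRepro2.BallStabilizerBounded
import Summits.Ventures.HodgeRepro2.BallFreeAction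
import Summits.Ventures.HodgeRepro2.BallMulAction
import Summits.Ventures.HodgeRepro2.BallProperU21
import Summits.Ventures.HodgeRepro2.BallQuotientHausdorff

/-!
# `𝔹² → Γ\𝔹²` is a covering map for torsion-free `Γ`

For a NEAT (hence torsion-free) `Γ`, Shimura (J. Math. Soc. Japan 31 (1979), §4) and DR15 §2 use
`Γ\𝔹²` as a smooth compact surface with `𝔹²` as its universal cover.  The topological content —
the quotient map is a covering map, so `Γ\𝔹²` is locally homeomorphic to the ball — follows from the
proper discontinuity (`BallQuotientHausdorff.lean`) and the freeness of the action
(`BallFreeAction.lean`) through Mathlib's `isQuotientCoveringMap_quotientMk_of_properlyDiscontinuousSMul`: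

* `isCancelSMul_frameAction_of_isTorsionFreeSet` — a torsion-free `S ⊆ Γ_N` acts freely in
  Mathlib's sense (`IsCancelSMul`);
* `isCoveringMap_ballQuotient_mk_of_isTorsionFreeSet` — **for a torsion-free subgroup `S ⊆ Γ_N`
  the quotient map `𝔹² → S\𝔹²` is a covering map**;
* `isCancelSMul_frameAction_shimuraLevel` / `isCoveringMap_ballQuotient_mk_shimuraLevel` — **for
  `N > 2`, `𝔹² → Γ_N\𝔹²` is a covering map** (`Γ_N` is torsion-free: `isTorsionFreeSet_shimuraLevel`,
  DR15 Lemma 1.4);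
* `isCoveringMap_ballQuotient_mk_of_isFiniteIndexSubgroupOf` — the same for the torsion-free
  finite-index subgroups `Γ ≤ Γ_1` quantified in `NonVanishingInput`.

Together with `t2Space_ballQuotient`, `locallyCompactSpace_ballQuotient` and
`secondCountableTopology_ballQuotient`: `Γ\𝔹²` is a Hausdorff, second countable space locally
homeomorphic to `ℂ²` — a topological 4-manifold.  Compactness and the complex structure stay prose.
-/

open Matrix

namespace Summit.Ventures.HodgeRepro2.ShimuraData

section CMField

variable {K : Type*} [Field K] [NumberField K] [NumberField.IsCMField K]

/-- A torsion-free subgroup `S ⊆ Γ_N` acts freely on the ball (`IsCancelSMul`). -/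
theorem isCancelSMul_frameAction_of_isTorsionFreeSet {τ₁ : K →+* ℂ} {H : Matrix (Fin 3) (Fin 3) K}
    (hH : IsHermitianForm K H)
    (hdef : ∀ τ : K →+* ℂ, NumberField.InfinitePlace.mk τ ≠ NumberField.InfinitePlace.mk τ₁ →
      IsDefiniteAt K τ H)
    {Q : Matrix (Fin 3) (Fin 3) ℂ} (hQ : IsFrame K τ₁ H Q) {𝔪 : Submodule ℤ (Fin 3 → K)}
    (h𝔪 : IsLattice K 𝔪) {N : ℕ} {S : Subgroup (GL (Fin 3) K)}
    (hS : (S : Set (GL (Fin 3) K)) ⊆ shimuraLevel K H 𝔪 N)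
    (htf : IsTorsionFreeSet K (S : Set (GL (Fin 3) K))) :
    letI := frameAction hQ S (subset_unitaryGroup_of_subset_shimuraLevel hS)
    IsCancelSMul S ball₂ := by
  letI := frameAction hQ S (subset_unitaryGroup_of_subset_shimuraLevel hS)
  rw [isCancelSMul_iff_eq_one_of_smul_eq]
  intro γ z h
  have h' : γ ∈ MulAction.stabilizer S z := MulAction.mem_stabilizer_iff.mpr h
  rw [mem_stabilizer_frameAction_iff] at h'
  exact Subtype.ext
    (eq_one_of_ballAction_eq_self_of_isTorsionFreeSet_of_subset hH hdef hQ h𝔪 hS htf γ.2 z.2 h')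

/-- **Covering map.**  For a torsion-free subgroup `S ⊆ Γ_N` the quotient map `𝔹² → S\𝔹²` is a
covering map. -/
theorem isCoveringMap_ballQuotient_mk_of_isTorsionFreeSet {τ₁ : K →+* ℂ}
    {H : Matrix (Fin 3) (Fin 3) K} (hH : IsHermitianForm K H)
    (hdef : ∀ τ : K →+* ℂ, NumberField.InfinitePlace.mk τ ≠ NumberField.InfinitePlace.mk τ₁ →
      IsDefiniteAt K τ H)
    {Q : Matrix (Fin 3) (Fin 3) ℂ} (hQ : IsFrame K τ₁ H Q) {𝔪 : Submodule ℤ (Fin 3 → K)}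
    (h𝔪 : IsLattice K 𝔪) {N : ℕ} {S : Subgroup (GL (Fin 3) K)}
    (hS : (S : Set (GL (Fin 3) K)) ⊆ shimuraLevel K H 𝔪 N)
    (htf : IsTorsionFreeSet K (S : Set (GL (Fin 3) K))) :
    IsCoveringMap (ballQuotient.mk hQ S (subset_unitaryGroup_of_subset_shimuraLevel hS)) := by
  letI := frameAction hQ S (subset_unitaryGroup_of_subset_shimuraLevel hS)
  haveI := continuousConstSMul_frameAction hQ S (subset_unitaryGroup_of_subset_shimuraLevel hS)
  haveI := properlyDiscontinuousSMul_frameAction hH hdef hQ h𝔪 hS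
  haveI := locallyCompactSpace_ball₂
  haveI := isCancelSMul_frameAction_of_isTorsionFreeSet hH hdef hQ h𝔪 hS htf
  exact (isQuotientCoveringMap_quotientMk_of_properlyDiscontinuousSMul (G := S)
    (E := ball₂)).isCoveringMap

/-- `Γ_N` acts freely on the ball for `N > 2` (`IsCancelSMul`). -/
theorem isCancelSMul_frameAction_shimuraLevel {τ₁ : K →+* ℂ} {H : Matrix (Fin 3) (Fin 3) K}
    (hH : IsHermitianForm K H)
    (hdef : ∀ τ : K →+* ℂ, NumberField.InfinitePlace.mk τ ≠ NumberField.InfinitePlace.mk τ₁ →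
      IsDefiniteAt K τ H)
    {Q : Matrix (Fin 3) (Fin 3) ℂ} (hQ : IsFrame K τ₁ H Q) {𝔪 : Submodule ℤ (Fin 3 → K)}
    (h𝔪 : IsLattice K 𝔪) {N : ℕ} (hN : 2 < N) :
    letI := frameAction hQ (shimuraLevelSubgroup K H 𝔪 N)
      (subset_unitaryGroup_of_subset_shimuraLevel (coe_shimuraLevelSubgroup K H 𝔪 N).subset)
    IsCancelSMul (shimuraLevelSubgroup K H 𝔪 N) ball₂ := by
  refine isCancelSMul_frameAction_of_isTorsionFreeSet hH hdef hQ h𝔪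
    (coe_shimuraLevelSubgroup K H 𝔪 N).subset ?_
  rw [coe_shimuraLevelSubgroup]
  exact isTorsionFreeSet_shimuraLevel τ₁ H h𝔪 hN

/-- **`𝔹² → Γ_N\𝔹²` is a covering map for `N > 2`.** -/
theorem isCoveringMap_ballQuotient_mk_shimuraLevel {τ₁ : K →+* ℂ} {H : Matrix (Fin 3) (Fin 3) K}
    (hH : IsHermitianForm K H)
    (hdef : ∀ τ : K →+* ℂ, NumberField.InfinitePlace.mk τ ≠ NumberField.InfinitePlace.mk τ₁ →
      IsDefiniteAt K τ H)
    {Q : Matrix (Fin 3) (Fin 3) ℂ} (hQ : IsFrame K τ₁ H Q) {𝔪 : Submodule ℤ (Fin 3 → K)}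
    (h𝔪 : IsLattice K 𝔪) {N : ℕ} (hN : 2 < N) :
    IsCoveringMap (ballQuotient.mk hQ (shimuraLevelSubgroup K H 𝔪 N)
      (subset_unitaryGroup_of_subset_shimuraLevel (coe_shimuraLevelSubgroup K H 𝔪 N).subset)) := by
  refine isCoveringMap_ballQuotient_mk_of_isTorsionFreeSet hH hdef hQ h𝔪
    (coe_shimuraLevelSubgroup K H 𝔪 N).subset ?_
  rw [coe_shimuraLevelSubgroup]
  exact isTorsionFreeSet_shimuraLevel τ₁ H h𝔪 hN

/-- **The same for the finite-index subgroups `Γ ≤ Γ_1` of `NonVanishingInput`, when torsion-free**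
(`Γ = ↑S` for a subgroup `S`, as `IsFiniteIndexSubgroupOf` provides). -/
theorem isCoveringMap_ballQuotient_mk_of_isFiniteIndexSubgroupOf {τ₁ : K →+* ℂ}
    {H : Matrix (Fin 3) (Fin 3) K} (hH : IsHermitianForm K H) (hP : IsPicardSignature K τ₁ H)
    {Q : Matrix (Fin 3) (Fin 3) ℂ} (hQ : IsFrame K τ₁ H Q) {𝔪 : Submodule ℤ (Fin 3 → K)}
    (h𝔪 : IsLattice K 𝔪) {S : Subgroup (GL (Fin 3) K)}
    (hΓ : IsFiniteIndexSubgroupOf K (S : Set (GL (Fin 3) K)) (shimuraLevel K H 𝔪 1))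
    (htf : IsTorsionFreeSet K (S : Set (GL (Fin 3) K))) :
    IsCoveringMap (ballQuotient.mk hQ S (subset_unitaryGroup_of_subset_shimuraLevel hΓ.subset)) :=
  isCoveringMap_ballQuotient_mk_of_isTorsionFreeSet hH hP.isDefiniteAt_of_ne hQ h𝔪 hΓ.subset htf

end CMField

end Summit.Ventures.HodgeRepro2.ShimuraData
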